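import Summits.QuantumFields.BalabanUV.T4Continuum.Support.NE7TorusCombGaugeKit
import Summits.QuantumFields.BalabanUV.T4Continuum.Support.NE7TorusCombPoints
import HarnessLib

/-!
# NE7TorusConeGaugePoincare — THE CONE (COMB) GAUGE POINCARÉ LEMMA ON A DISCRETE TORUS WITH QUADRATIC GROWTH: every 1-form `B` on
# `Tor M = Π_μ ℤ∕M_μ` is `∂m + c + B′` with `c` CONSTANT and `|B′(y,ν)| ≤ 2(d+1)·(1 + dist_T(y,y₀))²·sup|F_B|` around any base point `y₀`

Cell `pub-balaban`, rung (B)+1 sub-cell t4, lineage `b2b-balaban-t4-ne7-p1`, generation 65 (CRUX PROVER NE7 #1); hunt (h8) «REGULARITY ROAD»,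
step (h8-ii) LIN-ONE-STEP, file B2b of A ∕ B1 ∕ B2a ∕ B2b ∕ C (memo `t4/b2b-balaban-t4-ne7-p1-g64/HUNT-H8-REGULARITY-ROAD.md` §4).

WHY.  [Balaban1985Variational] Sect. F obtains the `C₁`-free regularity (8) of the minimiser from a generalized axial gauge centred at a point
`y` with LINEAR growth `|U′(x,x′) − 1| < |x − y|·2L²ε₀` ((145) p. 301) — the curvature controls the gauge field locally.  THIS FILE is the abelian
statement on the coarse torus `T₁ = Tor M` that file C feeds into the exponentially decaying curl-kernel of `H_k` (gen 64's
`NE7LinOneStepAbelianSup` ∕ lit-balaban's `B5Hk163TorusHolderDecay.norm_dker_bpt_le`) after file A (`NE7LinOneStepGaugeCovariance`) has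
removed `∂m + c`:
* the COMB GAUGE centred at `y₀` (axes taken in the order `0, 1, …, d`, each along the SHORT way — centred coordinates `s` of file B1,
  comb points `Q_i(y,t) = y₀ + (s(y)_0, …, s(y)_{i−1}, t, 0, …, 0)` and cycle holonomies `G_ν` of file B2a `NE7TorusCombPoints`):
  `λ(y) = Σ_i zs(t ↦ B(Q_i(y,t), i))(s(y)_i)`;
* its differential (`dlam_nowrap` ∕ `dlam_wrap`): `λ(y+e_ν) − λ(y) = B(y,ν) + Σ_{i>ν} zs(F_{νi}(B)∘Q_i(y,·))(s(y)_i)` — RIBBON FLUXES, discrete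
  Stokes — minus, on the bonds that WRAP around the torus in direction `ν`, the holonomy `G_ν` of the `ν`-cycle through `Q_ν(y,0)`;
* the wrap holonomy is referred to the reference cycle through `y₀` by the LIPSCHITZ WALK of B1 (`norm_G_comb_le`: cylinders of `M_ν·|s|₁`
  plaquettes, and `M_ν ≤ 2s(y)_ν + 1` on a wrap bond), and the indicator of the wrap bonds is itself `∂g_ν + 1∕M_ν` (exact + constant);
* **`coneGauge_exists`**: `∃ m a, ∀ y ν, |B(y,ν) − (∂¹m)(y,ν) − a_ν| ≤ 2(d+1)(1 + torusSupNorm M (rep y − rep y₀))²·f` whenever `|F_{μν}(B)| ≤ f`.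
Every auxiliary object (`zs`, `s`, `Q`, `G`, `λ`, `m`, `a`) is a hypothesis-carrying variable discharged at the end; no definition is introduced.
HONEST FRAMING (page 1): [folklore] lattice calculus; 0 def, 0 sorry; abelian, coarse unit torus; nothing of Bałaban's asserted; NOT ONE-STEP, NOT
NE7; spine 0∕9; finite T⁴ rung (B)+1 — NOT infinite volume, NOT mass gap, NOT Clay.  Continuum YM on T⁴ ⇐ BetaPertH ∧ nine spine estimates (0/9
proved); BetaPertH ⇐ (D1) ∧ (D4) ∧ CAP+tail; G-an2-4 gates asym, D1 and NE2/3/4.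
-/

set_option autoImplicit false

noncomputable section

open Finset Matrix

namespace Summit.QuantumFields.BalabanUV.T4Continuum.NE7TorusConeGaugePoincare

open Literature.MathematicalPhysics.QuantumFieldTheory.Balaban1983to89
open B4TorusKernel.MultiPeriod (torusSupNorm torusSupNorm_nonneg)
open B5Prop11Plancherel (Tor unitVec)
open B5Action121 (Fs Fs_apply GradOp GradOp_mulVec sdiff_mulVec)
open B5Hk160Torus (constV)
open B6LowerBound2153Torus (toT rep toT_add)
open B6Cov2156Torus (one_le_M)
open NE7TorusCombGaugeKit NE7TorusCombPoints

variable {d : ℕ} (M : Fin (d + 1) → ℕ) [hM : ∀ μ, NeZero (M μ)]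

/-! ## §1. The differential of the comb gauge -/

section Differential

variable (y₀ : Tor M) (s : Tor M → (Fin (d + 1) → ℤ))
  (hs1 : ∀ y, y₀ + toT M (s y) = y) (hs0 : s y₀ = 0)
  (hs2 : ∀ y (ν i : Fin (d + 1)), i ≠ ν → s (y + unitVec M ν) i = s y i)
  (hs3 : ∀ y (ν : Fin (d + 1)), s (y + unitVec M ν) ν = s y ν + 1 ∨
    (s (y + unitVec M ν) ν = s y ν + 1 - M ν ∧ (M ν : ℤ) ≤ 2 * s y ν + 1))
  (Q : ℕ → Tor M → ℤ → Tor M)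
  (hQ : ∀ i y t, Q i y t = y₀ + toT M (fun j => if (j : ℕ) < i then s y j else if (j : ℕ) = i then t else 0))
  (zs : (ℤ → ℂ) → ℤ → ℂ) (hz0 : ∀ f, zs f 0 = 0) (hzs : ∀ f s, zs f (s + 1) = zs f s + f s)
  (B : Tor M × Fin (d + 1) → ℂ)
  (G : Fin (d + 1) → Tor M → ℂ) (hG : ∀ ν p, G ν p = ∑ t ∈ Finset.range (M ν), B (p + (t : ℤ) • unitVec M ν, ν))
  (lam : Tor M → ℂ) (hlam : ∀ y, lam y = ∑ i : Fin (d + 1), zs (fun t => B (Q i y t, i)) (s y i))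

omit hM in
include hQ hs2 in
/-- axes before `ν`: the term does not change. [folklore] -/
theorem term_lt {i ν : Fin (d + 1)} (hi : (i : ℕ) < ν) (y : Tor M) :
    zs (fun t => B (Q i (y + unitVec M ν) t, i)) (s (y + unitVec M ν) i) = zs (fun t => B (Q i y t, i)) (s y i) := by
  have hne : i ≠ ν := fun h => by subst h; omega
  rw [hs2 y ν i hne]
  congr 1
  funext t
  rw [Q_left M y₀ s hs2 Q hQ (le_of_lt hi)]

omit hM in
include hQ hs2 hzs in
/-- the axis `ν`, NO WRAP: the term grows by `B(Q_{ν+1}(y,0), ν)`. [folklore] -/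
theorem term_eq_nowrap (ν : Fin (d + 1)) (y : Tor M) (hw : s (y + unitVec M ν) ν = s y ν + 1) :
    zs (fun t => B (Q ν (y + unitVec M ν) t, ν)) (s (y + unitVec M ν) ν) - zs (fun t => B (Q ν y t, ν)) (s y ν)
      = B (Q ((ν : ℕ) + 1) y 0, ν) := by
  have e : (fun t => B (Q ν (y + unitVec M ν) t, ν)) = fun t => B (Q ν y t, ν) := by
    funext t; rw [Q_left M y₀ s hs2 Q hQ le_rfl]
  rw [e, hw, hzs, ← Q_next M y₀ s Q hQ ν y]; ring

omit hM in
include hQ hs2 hz0 hzs hG in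
/-- the axis `ν`, WRAP: the term grows by `B(Q_{ν+1}(y,0), ν)` MINUS the holonomy of the `ν`-cycle through `Q_ν(y,0)`. [folklore] -/
theorem term_eq_wrap (ν : Fin (d + 1)) (y : Tor M) (hw : s (y + unitVec M ν) ν = s y ν + 1 - M ν) :
    zs (fun t => B (Q ν (y + unitVec M ν) t, ν)) (s (y + unitVec M ν) ν) - zs (fun t => B (Q ν y t, ν)) (s y ν)
      = B (Q ((ν : ℕ) + 1) y 0, ν) - G ν (Q ν y 0) := by
  have e : (fun t => B (Q ν (y + unitVec M ν) t, ν)) = fun t => B (Q ν y t, ν) := by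
    funext t; rw [Q_left M y₀ s hs2 Q hQ le_rfl]
  have hper : ∀ t, (fun t => B (Q ν y t, ν)) (t + M ν) = (fun t => B (Q ν y t, ν)) t := by
    intro t; simp only [Q_period M y₀ s Q hQ]
  rw [e, hw, zs_sub_period zs hz0 hzs _ (M ν) hper, hzs, ← Q_next M y₀ s Q hQ ν y, hG]
  have e2 : ∑ t ∈ Finset.range (M ν), B (Q ν y 0 + (t : ℤ) • unitVec M ν, ν) = ∑ t ∈ Finset.range (M ν), B (Q ν y t, ν) := by
    refine Finset.sum_congr rfl fun t _ => ?_
    rw [← Q_shift M y₀ s Q hQ]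
  rw [e2]; ring

include hQ hs2 hs3 hz0 hzs in
/-- axes after `ν`: the term changes by the RIBBON FLUX `zs(F_{νi}(B)∘Q_i(y,·))(s(y)_i)` plus a telescoping transport term. [folklore] -/
theorem term_gt {i ν : Fin (d + 1)} (hi : (ν : ℕ) < i) (y : Tor M) :
    zs (fun t => B (Q i (y + unitVec M ν) t, i)) (s (y + unitVec M ν) i) - zs (fun t => B (Q i y t, i)) (s y i)
      = zs (fun t => Fs M 1 B ν i (Q i y t)) (s y i) + (B (Q ((i : ℕ) + 1) y 0, ν) - B (Q i y 0, ν)) := by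
  have hne : i ≠ ν := fun h => by subst h; omega
  rw [hs2 y ν i hne, ← zs_sub zs hz0 hzs]
  have e : (fun t => B (Q i (y + unitVec M ν) t, i) - B (Q i y t, i))
      = fun t => Fs M 1 B ν i (Q i y t) + (B (Q i y (t + 1), ν) - B (Q i y t, ν)) := by
    funext t
    rw [Q_right M y₀ s hs2 Q hQ hs3 hi, Fs_apply, Q_step M y₀ s Q hQ]
    ring
  rw [e, zs_add zs hz0 hzs, zs_telescope zs hz0 hzs (fun t => B (Q i y t, ν)), Q_next M y₀ s Q hQ]

include hQ hs1 hs2 hs3 hz0 hzs hlam in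
/-- **THE DIFFERENTIAL OF THE COMB GAUGE ON A NON-WRAPPING BOND**: `λ(y+e_ν) − λ(y) = B(y,ν) + Σ_{i>ν} zs(F_{νi}(B)∘Q_i(y,·))(s(y)_i)`. [folklore] -/
theorem dlam_nowrap (ν : Fin (d + 1)) (y : Tor M) (hw : s (y + unitVec M ν) ν = s y ν + 1) :
    lam (y + unitVec M ν) - lam y
      = B (y, ν) + ∑ i : Fin (d + 1), (if (ν : ℕ) < i then zs (fun t => Fs M 1 B ν i (Q i y t)) (s y i) else 0) := by
  rw [hlam, hlam, ← Finset.sum_sub_distrib]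
  have e : ∀ i : Fin (d + 1),
      zs (fun t => B (Q i (y + unitVec M ν) t, i)) (s (y + unitVec M ν) i) - zs (fun t => B (Q i y t, i)) (s y i)
        = (if (ν : ℕ) < i then zs (fun t => Fs M 1 B ν i (Q i y t)) (s y i) else 0)
          + ((if (i : ℕ) = ν then B (Q ((i : ℕ) + 1) y 0, ν) else 0)
            + (if (ν : ℕ) < i then B (Q ((i : ℕ) + 1) y 0, ν) - B (Q i y 0, ν) else 0)) := by
    intro i
    rcases lt_trichotomy (i : ℕ) ν with h | h | h
    · rw [term_lt M y₀ s hs2 Q hQ zs B h, sub_self, if_neg (by omega), if_neg (by omega), if_neg (by omega)]; ring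
    · have hi : i = ν := Fin.ext h
      subst hi
      rw [term_eq_nowrap M y₀ s hs2 Q hQ zs hzs B i y hw, if_neg (lt_irrefl _), if_pos rfl, if_neg (lt_irrefl _)]; ring
    · rw [term_gt M y₀ s hs2 hs3 Q hQ zs hz0 hzs B h, if_pos h, if_neg (by omega), if_pos h]; ring
  simp only [e, Finset.sum_add_distrib]
  have ht := sum_comb_telescope (fun k => B (Q k y 0, ν)) ν
  simp only [Finset.sum_add_distrib] at ht
  rw [ht, Q_top M y₀ s hs1 Q hQ]
  ring

include hQ hs1 hs2 hs3 hz0 hzs hG hlam in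
/-- **THE DIFFERENTIAL OF THE COMB GAUGE ON A WRAPPING BOND**: the same minus the holonomy `G_ν(Q_ν(y,0))`. [folklore] -/
theorem dlam_wrap (ν : Fin (d + 1)) (y : Tor M) (hw : s (y + unitVec M ν) ν = s y ν + 1 - M ν) :
    lam (y + unitVec M ν) - lam y
      = B (y, ν) - G ν (Q ν y 0)
        + ∑ i : Fin (d + 1), (if (ν : ℕ) < i then zs (fun t => Fs M 1 B ν i (Q i y t)) (s y i) else 0) := by
  rw [hlam, hlam, ← Finset.sum_sub_distrib]
  have e : ∀ i : Fin (d + 1),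
      zs (fun t => B (Q i (y + unitVec M ν) t, i)) (s (y + unitVec M ν) i) - zs (fun t => B (Q i y t, i)) (s y i)
        = (if (ν : ℕ) < i then zs (fun t => Fs M 1 B ν i (Q i y t)) (s y i) else 0)
          + ((if (i : ℕ) = ν then B (Q ((i : ℕ) + 1) y 0, ν) else 0)
            + (if (ν : ℕ) < i then B (Q ((i : ℕ) + 1) y 0, ν) - B (Q i y 0, ν) else 0))
          - (if (i : ℕ) = ν then G ν (Q ν y 0) else 0) := by
    intro i
    rcases lt_trichotomy (i : ℕ) ν with h | h | h
    · rw [term_lt M y₀ s hs2 Q hQ zs B h, sub_self, if_neg (by omega), if_neg (by omega), if_neg (by omega),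
        if_neg (by omega)]; ring
    · have hi : i = ν := Fin.ext h
      subst hi
      rw [term_eq_wrap M y₀ s hs2 Q hQ zs hz0 hzs B G hG i y hw, if_neg (lt_irrefl _), if_pos rfl, if_neg (lt_irrefl _),
        if_pos rfl]; ring
    · rw [term_gt M y₀ s hs2 hs3 Q hQ zs hz0 hzs B h, if_pos h, if_neg (by omega), if_pos h, if_neg (by omega)]; ring
  simp only [e, Finset.sum_add_distrib, Finset.sum_sub_distrib]
  have ht := sum_comb_telescope (fun k => B (Q k y 0, ν)) ν
  simp only [Finset.sum_add_distrib] at ht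
  rw [ht, Q_top M y₀ s hs1 Q hQ]
  have hν : ∑ i : Fin (d + 1), (if (i : ℕ) = ν then G ν (Q ν y 0) else 0) = G ν (Q ν y 0) := by
    rw [Finset.sum_eq_single ν (fun i _ hi => if_neg (fun h => hi (Fin.ext h))) (fun h => (h (Finset.mem_univ ν)).elim),
      if_pos rfl]
  rw [hν]; ring

end Differential

/-! ## §2. The bounds and the cone gauge -/

section Bound

variable (y₀ : Tor M) (s : Tor M → (Fin (d + 1) → ℤ))
  (hs1 : ∀ y, y₀ + toT M (s y) = y) (hs0 : s y₀ = 0)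
  (hs2 : ∀ y (ν i : Fin (d + 1)), i ≠ ν → s (y + unitVec M ν) i = s y i)
  (hs3 : ∀ y (ν : Fin (d + 1)), s (y + unitVec M ν) ν = s y ν + 1 ∨
    (s (y + unitVec M ν) ν = s y ν + 1 - M ν ∧ (M ν : ℤ) ≤ 2 * s y ν + 1))
  (hs5 : ∀ y (i : Fin (d + 1)), |((s y i : ℤ) : ℝ)| ≤ torusSupNorm M (rep M y - rep M y₀))
  (Q : ℕ → Tor M → ℤ → Tor M)
  (hQ : ∀ i y t, Q i y t = y₀ + toT M (fun j => if (j : ℕ) < i then s y j else if (j : ℕ) = i then t else 0))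
  (zs : (ℤ → ℂ) → ℤ → ℂ) (hz0 : ∀ f, zs f 0 = 0) (hzs : ∀ f s, zs f (s + 1) = zs f s + f s)
  (B : Tor M × Fin (d + 1) → ℂ) {f : ℝ} (hF : ∀ y (μ ν : Fin (d + 1)), ‖Fs M 1 B μ ν y‖ ≤ f)
  (G : Fin (d + 1) → Tor M → ℂ) (hG : ∀ ν p, G ν p = ∑ t ∈ Finset.range (M ν), B (p + (t : ℤ) • unitVec M ν, ν))
  (lam : Tor M → ℂ) (hlam : ∀ y, lam y = ∑ i : Fin (d + 1), zs (fun t => B (Q i y t, i)) (s y i))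
  (m : Tor M → ℂ) (hm : ∀ y, m y = lam y - ∑ κ : Fin (d + 1), G κ y₀ * (s y κ : ℂ) / (M κ : ℂ))
  (a : Fin (d + 1) → ℂ) (ha : ∀ κ, a κ = G κ y₀ / (M κ : ℂ))

include hF in
/-- the curvature bound is non-negative. [folklore] -/
theorem f_nonneg : 0 ≤ f := (norm_nonneg _).trans (hF 0 0 0)

include hz0 hzs hF hs5 in
/-- **the ribbon fluxes are at most `(d+1)·dist·f`**. [folklore] -/
theorem norm_ribbon_le (ν : Fin (d + 1)) (y : Tor M) :
    ‖∑ i : Fin (d + 1), (if (ν : ℕ) < i then zs (fun t => Fs M 1 B ν i (Q i y t)) (s y i) else 0)‖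
      ≤ ((d : ℝ) + 1) * torusSupNorm M (rep M y - rep M y₀) * f := by
  have hD : 0 ≤ torusSupNorm M (rep M y - rep M y₀) := torusSupNorm_nonneg (one_le_M M) _
  have hf : 0 ≤ f := f_nonneg M B hF
  refine (norm_sum_le _ _).trans ?_
  calc ∑ i : Fin (d + 1), ‖(if (ν : ℕ) < i then zs (fun t => Fs M 1 B ν i (Q i y t)) (s y i) else 0)‖
      ≤ ∑ _i : Fin (d + 1), torusSupNorm M (rep M y - rep M y₀) * f := by
        refine Finset.sum_le_sum fun i _ => ?_
        split_ifs with h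
        · refine (norm_zs_le zs hz0 hzs _ (fun t => hF _ _ _) (s y i)).trans ?_
          exact mul_le_mul_of_nonneg_right (hs5 y i) hf
        · rw [norm_zero]; positivity
    _ = ((d : ℝ) + 1) * torusSupNorm M (rep M y - rep M y₀) * f := by
        rw [Finset.sum_const, Finset.card_univ, Fintype.card_fin, nsmul_eq_mul]; push_cast; ring

include hQ hF hG hs5 in
/-- **the wrap holonomy relative to the reference cycle**: `|G_ν(Q_ν(y,0)) − G_ν(y₀)| ≤ ν·dist·M_ν·f` — walk the base point from `y₀` to
`Q_ν(y,0)` along the first `ν` axes (B1's Lipschitz walk, `|s(y)_i| ≤ dist`). [folklore] -/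
theorem norm_G_comb_le (ν : Fin (d + 1)) (y : Tor M) :
    ‖G ν (Q ν y 0) - G ν y₀‖ ≤ (ν : ℝ) * (torusSupNorm M (rep M y - rep M y₀) * ((M ν : ℝ) * f)) := by
  have hD : 0 ≤ torusSupNorm M (rep M y - rep M y₀) := torusSupNorm_nonneg (one_le_M M) _
  -- walk axis by axis
  have hP : ∀ k : ℕ, k ≤ (ν : ℕ) →
      ‖G ν (Q k y 0) - G ν y₀‖ ≤ (k : ℝ) * (torusSupNorm M (rep M y - rep M y₀) * ((M ν : ℝ) * f)) := by
    intro k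
    induction k with
    | zero => intro _; rw [Q_base M y₀ s Q hQ, sub_self, norm_zero]; simp
    | succ k ih =>
      intro hk
      have hk' : k < d + 1 := by have := ν.isLt; omega
      have hstep : ‖G ν (Q (k + 1) y 0) - G ν (Q k y 0)‖
          ≤ torusSupNorm M (rep M y - rep M y₀) * ((M ν : ℝ) * f) := by
        have e : Q (k + 1) y 0 = Q k y 0 + s y ⟨k, hk'⟩ • unitVec M ⟨k, hk'⟩ := by
          rw [← Q_next M y₀ s Q hQ ⟨k, hk'⟩ y, ← Q_shift M y₀ s Q hQ ⟨k, hk'⟩ y]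
        rw [e]
        refine (norm_walk_le M (G ν) (unitVec M ⟨k, hk'⟩) (fun p => norm_G_step_le M B hF G hG ν ⟨k, hk'⟩ p)
          (Q k y 0) (s y ⟨k, hk'⟩)).trans ?_
        exact mul_le_mul_of_nonneg_right (hs5 y ⟨k, hk'⟩) (mul_nonneg (Nat.cast_nonneg _) (f_nonneg M B hF))
      calc ‖G ν (Q (k + 1) y 0) - G ν y₀‖
          = ‖(G ν (Q (k + 1) y 0) - G ν (Q k y 0)) + (G ν (Q k y 0) - G ν y₀)‖ := by congr 1; ring
        _ ≤ ‖G ν (Q (k + 1) y 0) - G ν (Q k y 0)‖ + ‖G ν (Q k y 0) - G ν y₀‖ := norm_add_le _ _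
        _ ≤ torusSupNorm M (rep M y - rep M y₀) * ((M ν : ℝ) * f)
              + (k : ℝ) * (torusSupNorm M (rep M y - rep M y₀) * ((M ν : ℝ) * f)) := add_le_add hstep (ih (by omega))
        _ = ((k + 1 : ℕ) : ℝ) * (torusSupNorm M (rep M y - rep M y₀) * ((M ν : ℝ) * f)) := by push_cast; ring
  exact hP ν le_rfl

omit hM in
include hs2 hm ha in
/-- the differential of `m = λ − Σ_κ G_κ(y₀)·s_κ∕M_κ` plus the constant `a_ν = G_ν(y₀)∕M_ν`, in terms of `λ` and the `ν`-coordinate step. [folklore] -/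
theorem dm_eq (ν : Fin (d + 1)) (y : Tor M) :
    (m (y + unitVec M ν) - m y) + a ν
      = (lam (y + unitVec M ν) - lam y)
        - G ν y₀ * ((s (y + unitVec M ν) ν : ℂ) - s y ν - 1) / (M ν : ℂ) := by
  rw [hm, hm, ha]
  have hsum : ∑ κ : Fin (d + 1), G κ y₀ * (s (y + unitVec M ν) κ : ℂ) / (M κ : ℂ)
      - ∑ κ : Fin (d + 1), G κ y₀ * (s y κ : ℂ) / (M κ : ℂ)
        = G ν y₀ * ((s (y + unitVec M ν) ν : ℂ) - s y ν) / (M ν : ℂ) := by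
    rw [← Finset.sum_sub_distrib]
    rw [Finset.sum_eq_single ν]
    · ring
    · intro κ _ hκ
      rw [hs2 y ν κ hκ]; ring
    · intro h; exact (h (Finset.mem_univ ν)).elim
  linear_combination (-1 : ℂ) * hsum

include hQ hs1 hs2 hs3 hs5 hz0 hzs hF hG hlam hm ha in
/-- **THE CONE GAUGE BOUND**: `|B(y,ν) − (m(y+e_ν) − m(y)) − a_ν| ≤ 2(d+1)(1 + dist_T(y,y₀))²·f` on every bond. [folklore] -/
theorem coneGauge_bound (ν : Fin (d + 1)) (y : Tor M) :
    ‖B (y, ν) - (m (y + unitVec M ν) - m y) - a ν‖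
      ≤ 2 * ((d : ℝ) + 1) * (1 + torusSupNorm M (rep M y - rep M y₀)) ^ 2 * f := by
  set D := torusSupNorm M (rep M y - rep M y₀) with hDdef
  have hD : 0 ≤ D := torusSupNorm_nonneg (one_le_M M) _
  have hf : 0 ≤ f := f_nonneg M B hF
  have hMν : (M ν : ℂ) ≠ 0 := by exact_mod_cast NeZero.ne (M ν)
  have hrib := norm_ribbon_le M y₀ s hs5 Q zs hz0 hzs B hF ν y
  have hνd : (ν : ℝ) ≤ d := by exact_mod_cast Nat.lt_succ_iff.mp ν.isLt
  have e0 : B (y, ν) - (m (y + unitVec M ν) - m y) - a ν = B (y, ν) - ((m (y + unitVec M ν) - m y) + a ν) := by ring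
  rw [e0, dm_eq M y₀ s hs2 G lam m hm a ha]
  rcases hs3 y ν with hw | ⟨hw, hwrap⟩
  · -- no wrap: only the ribbon fluxes survive
    rw [dlam_nowrap M y₀ s hs1 hs2 hs3 Q hQ zs hz0 hzs B lam hlam ν y hw, hw]
    have e1 : B (y, ν) - (B (y, ν) + ∑ i : Fin (d + 1), (if (ν : ℕ) < i then zs (fun t => Fs M 1 B ν i (Q i y t)) (s y i) else 0)
        - G ν y₀ * ((((s y ν + 1 : ℤ)) : ℂ) - s y ν - 1) / (M ν : ℂ))
        = -∑ i : Fin (d + 1), (if (ν : ℕ) < i then zs (fun t => Fs M 1 B ν i (Q i y t)) (s y i) else 0) := by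
      push_cast; ring
    rw [e1, norm_neg]
    refine hrib.trans ?_
    nlinarith [mul_nonneg hD hf, mul_nonneg (mul_nonneg hD hD) hf]
  · -- wrap: ribbon fluxes plus the holonomy difference
    rw [dlam_wrap M y₀ s hs1 hs2 hs3 Q hQ zs hz0 hzs B G hG lam hlam ν y hw, hw]
    have e1 : B (y, ν) - (B (y, ν) - G ν (Q ν y 0)
          + ∑ i : Fin (d + 1), (if (ν : ℕ) < i then zs (fun t => Fs M 1 B ν i (Q i y t)) (s y i) else 0)
        - G ν y₀ * ((((s y ν + 1 - M ν : ℤ)) : ℂ) - s y ν - 1) / (M ν : ℂ))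
        = (G ν (Q ν y 0) - G ν y₀)
          - ∑ i : Fin (d + 1), (if (ν : ℕ) < i then zs (fun t => Fs M 1 B ν i (Q i y t)) (s y i) else 0) := by
      push_cast; field_simp; ring
    rw [e1]
    refine (norm_sub_le _ _).trans ?_
    have hG' := norm_G_comb_le M y₀ s hs5 Q hQ B hF G hG ν y
    -- on a wrap bond the period is short: `M_ν ≤ 2 dist + 1`
    have hMle : (M ν : ℝ) ≤ 2 * D + 1 := by
      have h1 : ((M ν : ℤ) : ℝ) ≤ 2 * ((s y ν : ℤ) : ℝ) + 1 := by exact_mod_cast hwrap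
      have h2 : ((s y ν : ℤ) : ℝ) ≤ D := (le_abs_self _).trans (hs5 y ν)
      have h3 : ((M ν : ℤ) : ℝ) = (M ν : ℝ) := by norm_cast
      linarith
    have hG2 : ‖G ν (Q ν y 0) - G ν y₀‖ ≤ (d : ℝ) * (D * ((2 * D + 1) * f)) := by
      refine hG'.trans ?_
      have := mul_le_mul hνd (mul_le_mul_of_nonneg_left (mul_le_mul_of_nonneg_right hMle hf) hD)
        (by positivity) (Nat.cast_nonneg d)
      exact this
    nlinarith [mul_nonneg hD hf, mul_nonneg (mul_nonneg hD hD) hf, hG2, hrib]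

/-- **THE CONE (COMB) GAUGE POINCARÉ LEMMA ON THE DISCRETE TORUS** (existential, def-free): for every 1-form `B` on `Tor M` with
`|F_{μν}(B)| ≤ f` and every base point `y₀` there are a gauge function `m` and a CONSTANT field `a` with
`|B(y,ν) − (∂¹m)(y,ν) − a_ν| ≤ 2(d+1)·(1 + torusSupNorm M (rep y − rep y₀))²·f` on every bond `(y,ν)`. [folklore] -/
theorem coneGauge_exists (B : Tor M × Fin (d + 1) → ℂ) (y₀ : Tor M) {f : ℝ} (hF : ∀ y (μ ν : Fin (d + 1)), ‖Fs M 1 B μ ν y‖ ≤ f) :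
    ∃ (m : Tor M → ℂ) (a : Fin (d + 1) → ℂ), ∀ y (ν : Fin (d + 1)),
      ‖B (y, ν) - (GradOp M 1 *ᵥ m) (y, ν) - constV M a (y, ν)‖
        ≤ 2 * ((d : ℝ) + 1) * (1 + torusSupNorm M (rep M y - rep M y₀)) ^ 2 * f := by
  obtain ⟨zs, hz0, hzs⟩ := exists_signedSum
  obtain ⟨s, hs1, -, hs2, hs3, hs5⟩ := exists_centredCoords M y₀
  let Q : ℕ → Tor M → ℤ → Tor M :=
    fun i y t => y₀ + toT M (fun j => if (j : ℕ) < i then s y j else if (j : ℕ) = i then t else 0)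
  let G : Fin (d + 1) → Tor M → ℂ := fun ν p => ∑ t ∈ Finset.range (M ν), B (p + (t : ℤ) • unitVec M ν, ν)
  let lam : Tor M → ℂ := fun y => ∑ i : Fin (d + 1), zs (fun t => B (Q i y t, i)) (s y i)
  let m : Tor M → ℂ := fun y => lam y - ∑ κ : Fin (d + 1), G κ y₀ * (s y κ : ℂ) / (M κ : ℂ)
  let a : Fin (d + 1) → ℂ := fun κ => G κ y₀ / (M κ : ℂ)
  refine ⟨m, a, fun y ν => ?_⟩
  rw [GradOp_mulVec, sdiff_mulVec, one_mul]
  exact coneGauge_bound M y₀ s hs1 hs2 hs3 hs5 Q (fun _ _ _ => rfl) zs hz0 hzs B hF G (fun _ _ => rfl)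
    lam (fun _ => rfl) m (fun _ => rfl) a (fun _ => rfl) ν y

end Bound

end Summit.QuantumFields.BalabanUV.T4Continuum.NE7TorusConeGaugePoincare
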